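import Summits.QuantumFields.BalabanUV.T4Continuum.Support.CovariantMeanDepth
import Literature.MathematicalPhysics.QuantumFieldTheory.Balaban1983to89.T4SegmentCurvature

/-!
# `T4Continuum.CovariantMeanLatticeDisc` (cell-tree module `Summits/QuantumFields/BalabanUV/T4Continuum/Support/CovariantMeanLatticeDisc.lean`)
# — road P4 of the spine estimate NE1′, tangent-map formulation (v2): the DEPTH LEMMA L8-DL on the LATTICE, exactly —
# the exponential disc `ζ ↦ (b ↦ exp(ζ·B_b))` through the trivial configuration and the axial-gauge copy `exp B` of a
# configuration; its plaquettes are controlled FROM THE ENDPOINT by the ordered-product bounds of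
# `…Balaban1983to89.T4SegmentCurvature` (no bilinear caricature of the curvature: the full non-commutative product);
# its potentials grow linearly; hence the disc of radius `Λ` stays inside every analyticity domain that CONTAINS the
# pure-potential configurations with plaquettes within `a` of `1` and potentials below `ρ`, and the disc form of the
# Schwarz lemma (`CovariantMeanRecursion.norm_le_div_of_disc`, p209931) gives `‖Φ(exp B)‖ ≤ N/Λ`; in the letters of the
# road: plaquette deviation `δ ≤ θ·a` (relative depth `θ`), potentials `β ≤ K·δ` (axial gauge), `16K²a < 1`, `K·a < 2ρ`
# ⟹ `‖Φ(exp B)‖ ≤ 2θ·N` (assembled in the sibling `Support.CovariantMeanLatticeDepth`, with the dictionary arithmetic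
# over the typed printed radii `…B14Radii`), and without the support-size condition `‖Φ(exp B)‖ ≤ N·max(2θ, 2β/ρ)`
# (cell `pub-balaban`, sub-cell `t4`, ROUND-2 prover seat #4 of BINDER-OWNERS row NE1′, unit `b2b-balaban-t4-ne1p-p4`,
# generation 3; companion of the HOME record `t4/b2b-balaban-t4-ne1p-p4/PROPAGATION-v2.md` §2.4, §4.3, §4.5 (N2′) and
# of the skeleton `t4/skeletons/NE1p-t4-ne1p-p4.md` leaf L8-DL, formalisable-now item (f7′); ADDITIVE — imports its
# sibling `Support.CovariantMeanDepth` (p210336) and `…Balaban1983to89.T4SegmentCurvature` only; nothing modified)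

HONEST FRAMING.  Finite four-torus, rung (B)+1 only.  NOT infinite volume, NOT a mass gap, NOT the Clay problem, NOT
summit progress.  HONEST DEPENDENCY: continuum YM on T⁴ ⇐ BetaPertH ∧ nine spine estimates (0/9 proved); BetaPertH ⇐
(D1) ∧ (D4) ∧ CAP+tail; G-an2-4 gates asym, D1 and NE2/3/4.  This module is elementary (the exponential in a Banach
algebra, one-variable complex differentiability, real arithmetic); it asserts nothing about T. Bałaban's densities or
spaces; every declaration is [folklore] and sorry-free.  What it replaces: in `CovariantMeanDepth` §2 (p210336) the
curvature was MODELLED as `dA + bAA`; here the plaquette variable of the disc configuration is the honest ordered product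
`exp(ζB₁)exp(ζB₂)exp(−ζB₃)exp(−ζB₄)` and its deviation from `1` is bounded from the deviation AT `ζ = 1` (the
configuration's own plaquette) plus second-order remainders in the potentials (`T4SegmentCurvature.
norm_hol_sub_one_le_of_endpoint`, BY NAME).

WHAT REMAINS A HYPOTHESIS SHAPE / IS NOT DONE HERE (read before citing).  (r1) `ContainsSmall S plaqs a ρ` — «the
analyticity domain `S` contains every pure-potential configuration `exp M` whose plaquettes (from the list `plaqs`) are
within `a` of `1` and whose potentials have norm `< ρ`» — is the CONSERVATIVE reading of the printed multi-scale
regularity spaces (plaquette clause + potential clauses for the unitary and the complex part, both measured by `‖M_b‖`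
in the GIVEN gauge; the difference-quotient clauses and the per-cube gauge freedom of the printed potential clause are
NOT modelled, which is why a support-size quantity `β/ρ` appears in `depth_gain_lattice_two_regime`); it is asserted for
no object of the series.  (r2) The axial gauge enters only through the letter `K` (`β ≤ K·δ`): the group-level statement
«plaquette-small on a non-wrapping box ⟹ the axial-gauge copy is bond-small, constant `(d − 1)·side`» is the tree's
`…T4AxialGaugeSmallField.dist1_gaugeAct_axialGauge_le_uniform` (in `dist1`); the passage from `dist1` to the norm of a
logarithm `B_b` is a chart statement on a different carrier and is not composed here.  (r3) `Φ 1 = 0` (flatness-zero at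
the trivial configuration) is supplied on the road by covariance (`CovariantMeanDepth` §1); here it is a hypothesis.
(r4) Analyticity of `Φ` on an open subset of the ambient linear space `𝔅 → 𝔸` (rather than of the complex group) is
the model's; for matrix groups a holomorphic retraction onto the group near `1` justifies it, not formalised.

CITATION HEADER (lean-in-tree rule).  No page of the series (CMP 1983–89) or of any other source is quoted or
attributed; the printed loci that MOTIVATE the hypothesis shapes ([Balaban1987RG1] (1.11)–(1.14) p. 262,
[Balaban1988Convergent] (2.34)–(2.39) p. 261) are quoted in the imported `…T4SegmentCurvature` header and in `…B14Radii`
and are not re-cited.  Objects re-used BY NAME: `…T4SegmentCurvature.norm_hol_sub_one_le_of_endpoint`,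
`…T4SegmentCurvature.exp_sub_one_sub_mono`, `CovariantMeanRecursion.norm_le_div_of_disc` (this seat, p209931), Mathlib
`differentiable_exp_smul_const`, `Real.abs_exp_sub_one_sub_id_le`.
-/

noncomputable section

open NormedSpace Set Metric

namespace Summit.QuantumFields.BalabanUV.T4Continuum.CovariantMeanLatticeDisc

open Literature.MathematicalPhysics.QuantumFieldTheory.Balaban1983to89.T4SegmentCurvature
  (norm_hol_sub_one_le_of_endpoint exp_sub_one_sub_mono)

/-! ## §1 The exponential disc of a pure-potential configuration: plaquettes and potentials along it -/

section Disc

variable {𝔅 : Type*} [Fintype 𝔅] {𝔸 : Type*} [NormedRing 𝔸] [NormedAlgebra ℂ 𝔸] [CompleteSpace 𝔸]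

/-- The exponential disc through the trivial configuration (`ζ = 0`) and the pure-potential configuration `exp B`
(`ζ = 1`): `disc B ζ = (b ↦ exp(ζ·B_b))`.  On the road `B` is the family of axial-gauge logarithms of a configuration
on the bonds `𝔅` of a localization domain. [folklore] -/
def disc (B : 𝔅 → 𝔸) (ζ : ℂ) : 𝔅 → 𝔸 := fun b => exp (ζ • B b)

omit [Fintype 𝔅] [CompleteSpace 𝔸] in
/-- `disc B 0 = 1` (the trivial configuration). [folklore] -/
@[simp] theorem disc_zero (B : 𝔅 → 𝔸) : disc B 0 = 1 := by
  funext b; simp [disc]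

omit [Fintype 𝔅] [CompleteSpace 𝔸] in
/-- `disc B 1 = exp B`. [folklore] -/
@[simp] theorem disc_one (B : 𝔅 → 𝔸) : disc B 1 = fun b => exp (B b) := by
  funext b; simp [disc]

omit [Fintype 𝔅] in
/-- The disc is ENTIRE (Mathlib `differentiable_exp_smul_const`, bondwise). [folklore] -/
theorem differentiable_disc (B : 𝔅 → 𝔸) : Differentiable ℂ (disc B) :=
  differentiable_pi'' fun b => differentiable_exp_smul_const ℂ (B b)

omit [Fintype 𝔅] [CompleteSpace 𝔸] in
/-- Potentials grow linearly along the disc: `‖ζ·B_b‖ ≤ ‖ζ‖·β`. [folklore] -/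
theorem norm_smul_le_of_le (B : 𝔅 → 𝔸) {β : ℝ} (hβ : ∀ b, ‖B b‖ ≤ β) (ζ : ℂ) (b : 𝔅) :
    ‖ζ • B b‖ ≤ ‖ζ‖ * β := by
  rw [norm_smul]; exact mul_le_mul_of_nonneg_left (hβ b) (norm_nonneg _)

/-- The plaquette variable of the disc configuration over the four bonds `p = (b₁, b₂, b₃, b₄)` of a plaquette, the last
two traversed backwards: the ORDERED product `exp(ζB₁)·exp(ζB₂)·exp(−ζB₃)·exp(−ζB₄)` (no commutative caricature).
At `ζ = 1` it is the configuration's own plaquette variable. [folklore] -/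
def discHol (B : 𝔅 → 𝔸) (p : 𝔅 × 𝔅 × 𝔅 × 𝔅) (ζ : ℂ) : 𝔸 :=
  exp (ζ • B p.1) * exp (ζ • B p.2.1) * exp (-(ζ • B p.2.2.1)) * exp (-(ζ • B p.2.2.2))

/-- The second-order remainder `rem t = eᵗ − 1 − t`. [folklore] -/
def rem (t : ℝ) : ℝ := Real.exp t - 1 - t

/-- `rem t ≤ t²` for `0 ≤ t ≤ 1`. [folklore] -/
theorem rem_le_sq {t : ℝ} (h0 : 0 ≤ t) (h1 : t ≤ 1) : rem t ≤ t ^ 2 := by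
  have h := Real.abs_exp_sub_one_sub_id_le (x := t) (by rwa [abs_of_nonneg h0])
  exact (le_abs_self _).trans h

/-- `rem` is monotone on `[0, ∞)`. [folklore] -/
theorem rem_mono {u t : ℝ} (hu : 0 ≤ u) (hut : u ≤ t) : rem u ≤ rem t :=
  exp_sub_one_sub_mono hu hut

omit [Fintype 𝔅] in
/-- **PLAQUETTES ALONG THE DISC, FROM THE ENDPOINT** (`T4SegmentCurvature.norm_hol_sub_one_le_of_endpoint` with
endpoint `c₁ = 1`): if every potential has norm `≤ β`, then
`‖discHol B p ζ − 1‖ ≤ ‖ζ‖·(‖discHol B p 1 − 1‖ + rem(4β)) + rem(4‖ζ‖β)` — first order in the configuration's own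
plaquette deviation, second order in the potentials. [folklore] -/
theorem norm_discHol_sub_one_le (B : 𝔅 → 𝔸) (p : 𝔅 × 𝔅 × 𝔅 × 𝔅) {β : ℝ} (hβ : ∀ b, ‖B b‖ ≤ β) (ζ : ℂ) :
    ‖discHol B p ζ - 1‖ ≤ ‖ζ‖ * (‖discHol B p 1 - 1‖ + rem (4 * β)) + rem (4 * ‖ζ‖ * β) := by
  have h := norm_hol_sub_one_le_of_endpoint (𝕂 := ℂ) (𝔸 := 𝔸) (c₁ := (1 : ℂ)) one_ne_zero ζ
    (B p.1) (B p.2.1) (B p.2.2.1) (B p.2.2.2)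
  set S := ‖B p.1‖ + ‖B p.2.1‖ + ‖B p.2.2.1‖ + ‖B p.2.2.2‖ with hS_def
  have hS0 : 0 ≤ S := by positivity
  have hS4 : S ≤ 4 * β := by
    have := hβ p.1; have := hβ p.2.1; have := hβ p.2.2.1; have := hβ p.2.2.2
    simp only [hS_def]; linarith
  have hζ0 : 0 ≤ ‖ζ‖ := norm_nonneg _
  rw [norm_one, div_one, one_mul] at h
  have h1 : rem S ≤ rem (4 * β) := rem_mono hS0 hS4
  have h2 : rem (‖ζ‖ * S) ≤ rem (4 * ‖ζ‖ * β) := by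
    refine rem_mono (mul_nonneg hζ0 hS0) ?_
    calc ‖ζ‖ * S ≤ ‖ζ‖ * (4 * β) := mul_le_mul_of_nonneg_left hS4 hζ0
      _ = 4 * ‖ζ‖ * β := by ring
  have h3 : ‖ζ‖ * (‖discHol B p 1 - 1‖ + rem S) ≤ ‖ζ‖ * (‖discHol B p 1 - 1‖ + rem (4 * β)) :=
    mul_le_mul_of_nonneg_left (by linarith) hζ0
  unfold discHol at h3 ⊢
  unfold rem at h1 h2 h3 ⊢
  linarith

omit [Fintype 𝔅] in
/-- QUADRATIC REGIME: with the configuration's plaquette deviation `≤ δ`, `‖ζ‖ ≤ Λ`, `1 ≤ Λ`, `0 ≤ β` and `4Λβ ≤ 1`: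
`‖discHol B p ζ − 1‖ ≤ Λδ + 32Λ²β²`. [folklore] -/
theorem norm_discHol_sub_one_le_quad (B : 𝔅 → 𝔸) (p : 𝔅 × 𝔅 × 𝔅 × 𝔅) {β δ Λ : ℝ} (hβ0 : 0 ≤ β)
    (hβ : ∀ b, ‖B b‖ ≤ β) (hδ : ‖discHol B p 1 - 1‖ ≤ δ) (hΛ : 1 ≤ Λ) (h4 : 4 * Λ * β ≤ 1) {ζ : ℂ}
    (hζ : ‖ζ‖ ≤ Λ) : ‖discHol B p ζ - 1‖ ≤ Λ * δ + 32 * Λ ^ 2 * β ^ 2 := by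
  have h := norm_discHol_sub_one_le B p hβ ζ
  have hζ0 : 0 ≤ ‖ζ‖ := norm_nonneg _
  have hΛ0 : 0 ≤ Λ := zero_le_one.trans hΛ
  have h4β : 4 * β ≤ 1 := by nlinarith
  have hr1 : rem (4 * β) ≤ 16 * β ^ 2 := by
    have := rem_le_sq (t := 4 * β) (by positivity) h4β; nlinarith
  have hr2 : rem (4 * ‖ζ‖ * β) ≤ 16 * Λ ^ 2 * β ^ 2 := by
    have hm : rem (4 * ‖ζ‖ * β) ≤ rem (4 * Λ * β) :=
      rem_mono (by positivity) (by nlinarith)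
    have hq := rem_le_sq (t := 4 * Λ * β) (by positivity) h4
    nlinarith
  have hδ0 : 0 ≤ δ := (norm_nonneg _).trans hδ
  have h3 : ‖ζ‖ * (‖discHol B p 1 - 1‖ + rem (4 * β)) ≤ Λ * (δ + 16 * β ^ 2) := by
    have e1 : ‖discHol B p 1 - 1‖ + rem (4 * β) ≤ δ + 16 * β ^ 2 := add_le_add hδ hr1
    have e0 : 0 ≤ ‖discHol B p 1 - 1‖ + rem (4 * β) := by
      have : 0 ≤ rem (4 * β) := by
        unfold rem; nlinarith [Real.add_one_le_exp (4 * β)]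
      positivity
    calc ‖ζ‖ * (‖discHol B p 1 - 1‖ + rem (4 * β)) ≤ Λ * (‖discHol B p 1 - 1‖ + rem (4 * β)) :=
          mul_le_mul_of_nonneg_right hζ e0
      _ ≤ Λ * (δ + 16 * β ^ 2) := mul_le_mul_of_nonneg_left e1 hΛ0
  have hΛΛ : Λ ≤ Λ ^ 2 := by nlinarith
  have h5 : Λ * (16 * β ^ 2) ≤ 16 * Λ ^ 2 * β ^ 2 := by
    have := mul_le_mul_of_nonneg_right hΛΛ (by positivity : (0 : ℝ) ≤ 16 * β ^ 2)
    linarith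
  nlinarith

end Disc

/-! ## §2 The model hypothesis on the analyticity domain and the lattice depth gain -/

section Gain

variable {𝔅 : Type*} [Fintype 𝔅] {𝔸 : Type*} [NormedRing 𝔸] [NormedAlgebra ℂ 𝔸] [CompleteSpace 𝔸]
  {F : Type*} [NormedAddCommGroup F] [NormedSpace ℂ F]

/-- «SMALL PURE-POTENTIAL CONFIGURATION» with respect to a list `plaqs` of plaquettes (four bonds each), a plaquette radius
`a` and a potential radius `ρ`: the pure-potential configuration `exp M` has every listed plaquette variable within `a`
of `1` and every potential of norm `< ρ` (the potential norm bounds BOTH the unitary and the positive factor of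
`exp M_b`, i.e. the real- and the complex-part clauses of the printed spaces, in the GIVEN gauge — the conservative
reading (r1) of the header). A predicate; nothing is asserted. [folklore] -/
def SmallPurePotential (plaqs : Set (𝔅 × 𝔅 × 𝔅 × 𝔅)) (a ρ : ℝ) (M : 𝔅 → 𝔸) : Prop :=
  (∀ p ∈ plaqs, ‖exp (M p.1) * exp (M p.2.1) * exp (-(M p.2.2.1)) * exp (-(M p.2.2.2)) - 1‖ < a) ∧ ∀ b, ‖M b‖ < ρ

/-- THE CONTAINMENT HYPOTHESIS SHAPE (r1): the analyticity domain `S` contains every small pure-potential configuration.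
A predicate on `S`; asserted for no object of the series. [folklore] -/
def ContainsSmall (S : Set (𝔅 → 𝔸)) (plaqs : Set (𝔅 × 𝔅 × 𝔅 × 𝔅)) (a ρ : ℝ) : Prop :=
  ∀ M : 𝔅 → 𝔸, SmallPurePotential plaqs a ρ M → (fun b => exp (M b)) ∈ S

omit [Fintype 𝔅] [NormedAlgebra ℂ 𝔸] [CompleteSpace 𝔸] in
/-- Non-vacuity: the zero potential is small for positive radii (its plaquette variables are `1`). [folklore] -/
theorem smallPurePotential_zero (plaqs : Set (𝔅 × 𝔅 × 𝔅 × 𝔅)) {a ρ : ℝ} (ha : 0 < a) (hρ : 0 < ρ) :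
    SmallPurePotential plaqs a ρ (0 : 𝔅 → 𝔸) :=
  ⟨fun p _ => by simpa using ha, fun b => by simpa using hρ⟩

omit [Fintype 𝔅] [NormedAlgebra ℂ 𝔸] [CompleteSpace 𝔸] in
/-- Non-vacuity: the whole configuration space contains the small configurations. [folklore] -/
theorem containsSmall_univ (plaqs : Set (𝔅 × 𝔅 × 𝔅 × 𝔅)) (a ρ : ℝ) :
    ContainsSmall (Set.univ : Set (𝔅 → 𝔸)) plaqs a ρ :=
  fun _ _ => Set.mem_univ _

omit [Fintype 𝔅] [NormedAlgebra ℂ 𝔸] [CompleteSpace 𝔸] in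
/-- Under `ContainsSmall S plaqs a ρ` with positive radii the trivial configuration lies in `S`. [folklore] -/
theorem one_mem_of_containsSmall {S : Set (𝔅 → 𝔸)} {plaqs : Set (𝔅 × 𝔅 × 𝔅 × 𝔅)} {a ρ : ℝ}
    (hS : ContainsSmall S plaqs a ρ) (ha : 0 < a) (hρ : 0 < ρ) : (1 : 𝔅 → 𝔸) ∈ S := by
  have h := hS 0 (smallPurePotential_zero plaqs ha hρ)
  have e : (fun b : 𝔅 => exp ((0 : 𝔅 → 𝔸) b)) = (1 : 𝔅 → 𝔸) := by funext b; simp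
  rwa [e] at h

omit [Fintype 𝔅] in
/-- THE DISC STAYS INSIDE: under `ContainsSmall S plaqs a ρ`, potentials `≤ β` (`0 ≤ β`), listed plaquette deviations of
`exp B` at most `δ`, and a radius `Λ ≥ 1` with `4Λβ ≤ 1`, `Λδ + 32Λ²β² < a`, `Λβ < ρ`, the disc maps the ball of radius
`Λ` into `S`. [folklore] -/
theorem mapsTo_disc {S : Set (𝔅 → 𝔸)} {plaqs : Set (𝔅 × 𝔅 × 𝔅 × 𝔅)} {a ρ : ℝ} (hS : ContainsSmall S plaqs a ρ)
    {B : 𝔅 → 𝔸} {β δ Λ : ℝ} (hβ0 : 0 ≤ β) (hβ : ∀ b, ‖B b‖ ≤ β) (hδ : ∀ p ∈ plaqs, ‖discHol B p 1 - 1‖ ≤ δ)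
    (hΛ : 1 ≤ Λ) (h4 : 4 * Λ * β ≤ 1) (ha : Λ * δ + 32 * Λ ^ 2 * β ^ 2 < a) (hρ : Λ * β < ρ) :
    MapsTo (disc B) (ball 0 Λ) S := by
  intro ζ hζ
  rw [mem_ball, dist_zero_right] at hζ
  apply hS (fun b => ζ • B b)
  refine ⟨fun p hp => ?_, fun b => ?_⟩
  · have h := norm_discHol_sub_one_le_quad B p hβ0 hβ (hδ p hp) hΛ h4 hζ.le
    unfold discHol at h
    exact lt_of_le_of_lt h ha
  · calc ‖ζ • B b‖ ≤ ‖ζ‖ * β := norm_smul_le_of_le B hβ ζ b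
      _ ≤ Λ * β := mul_le_mul_of_nonneg_right hζ.le hβ0
      _ < ρ := hρ

/-- **THE LATTICE DEPTH GAIN (parametric form).**  Let `Φ` be differentiable on an open set `S` of configurations,
bounded by `N` there, vanishing at the trivial configuration `1` (flatness-zero, (r3)), and let `S` contain the small
pure-potential configurations (`ContainsSmall S plaqs a ρ`, (r1)).  If the potentials `B` have norm `≤ β`, the listed
plaquettes of `exp B` deviate from `1` by at most `δ`, and `Λ > 1` satisfies `4Λβ ≤ 1`, `Λδ + 32Λ²β² < a`, `Λβ < ρ`,
then `‖Φ(exp B)‖ ≤ N/Λ`. [folklore] -/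
theorem depth_gain_lattice {S : Set (𝔅 → 𝔸)} {plaqs : Set (𝔅 × 𝔅 × 𝔅 × 𝔅)} {a ρ N : ℝ} {Φ : (𝔅 → 𝔸) → F}
    (hSo : IsOpen S) (hS : ContainsSmall S plaqs a ρ) (hΦ : DifferentiableOn ℂ Φ S) (hN : ∀ V ∈ S, ‖Φ V‖ ≤ N)
    (h0 : Φ 1 = 0) {B : 𝔅 → 𝔸} {β δ Λ : ℝ} (hβ0 : 0 ≤ β) (hβ : ∀ b, ‖B b‖ ≤ β)
    (hδ : ∀ p ∈ plaqs, ‖discHol B p 1 - 1‖ ≤ δ) (hΛ : 1 < Λ) (h4 : 4 * Λ * β ≤ 1)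
    (ha : Λ * δ + 32 * Λ ^ 2 * β ^ 2 < a) (hρ : Λ * β < ρ) :
    ‖Φ (fun b => exp (B b))‖ ≤ N / Λ := by
  have hmaps := mapsTo_disc hS hβ0 hβ hδ hΛ.le h4 ha hρ
  have h0' : Φ (disc B 0) = 0 := by rw [disc_zero]; exact h0
  have h := CovariantMeanRecursion.norm_le_div_of_disc hΛ hSo hΦ hN (differentiable_disc B) hmaps h0'
  rwa [disc_one] at h

/-- **THE LATTICE DEPTH GAIN (deep regime, explicit).**  In the letters of the road: the configuration is at RELATIVE
DEPTH `θ` inside the birth space (`δ ≤ θ·a`, `0 < θ < 1/2`, `0 < a ≤ 1`), the potentials are second-order small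
(`16β² < θ²a` — the numeric side condition N2′) and fit the potential radius (`β < 2θρ` — the support-size condition);
then, with `Λ = 1/(2θ)`, `‖Φ(exp B)‖ ≤ 2θ·N`: a covariant insertion evaluated `θ`-deep inside its analyticity space is
suppressed by the depth. [folklore] -/
theorem depth_gain_lattice_deep {S : Set (𝔅 → 𝔸)} {plaqs : Set (𝔅 × 𝔅 × 𝔅 × 𝔅)} {a ρ N : ℝ} {Φ : (𝔅 → 𝔸) → F}
    (hSo : IsOpen S) (hS : ContainsSmall S plaqs a ρ) (hΦ : DifferentiableOn ℂ Φ S) (hN : ∀ V ∈ S, ‖Φ V‖ ≤ N)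
    (h0 : Φ 1 = 0) {B : 𝔅 → 𝔸} {β δ θ : ℝ} (hβ0 : 0 ≤ β) (hβ : ∀ b, ‖B b‖ ≤ β)
    (hδ : ∀ p ∈ plaqs, ‖discHol B p 1 - 1‖ ≤ δ) (hθ0 : 0 < θ) (hθ : θ < 1 / 2) (ha1 : a ≤ 1)
    (hδθ : δ ≤ θ * a) (hquad : 16 * β ^ 2 < θ ^ 2 * a) (hsupp : β < 2 * θ * ρ) :
    ‖Φ (fun b => exp (B b))‖ ≤ 2 * θ * N := by
  set Λ : ℝ := 1 / (2 * θ) with hΛ_def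
  have hΛθ : Λ * θ = 1 / 2 := by rw [hΛ_def]; field_simp
  have hΛ1 : 1 < Λ := by rw [hΛ_def, lt_div_iff₀ (by positivity)]; linarith
  have hΛ0 : 0 < Λ := zero_lt_one.trans hΛ1
  have ha0 : 0 < a := by nlinarith
  -- `β < θ/2` from the quadratic condition and `a ≤ 1`
  have hβθ : 2 * β ≤ θ := by nlinarith
  have h4 : 4 * Λ * β ≤ 1 := by
    have : 4 * Λ * β = 2 * Λ * (2 * β) := by ring
    rw [this]; nlinarith
  have ha : Λ * δ + 32 * Λ ^ 2 * β ^ 2 < a := by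
    have e1 : Λ * δ ≤ a / 2 := by
      calc Λ * δ ≤ Λ * (θ * a) := mul_le_mul_of_nonneg_left hδθ hΛ0.le
        _ = (Λ * θ) * a := by ring
        _ = a / 2 := by rw [hΛθ]; ring
    have e2 : 32 * Λ ^ 2 * β ^ 2 < a / 2 := by
      have : 32 * Λ ^ 2 * β ^ 2 = 2 * Λ ^ 2 * (16 * β ^ 2) := by ring
      rw [this]
      calc 2 * Λ ^ 2 * (16 * β ^ 2) < 2 * Λ ^ 2 * (θ ^ 2 * a) :=
            mul_lt_mul_of_pos_left hquad (by positivity)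
        _ = 2 * (Λ * θ) ^ 2 * a := by ring
        _ = a / 2 := by rw [hΛθ]; ring
    linarith
  have hρ : Λ * β < ρ := by
    calc Λ * β < Λ * (2 * θ * ρ) := mul_lt_mul_of_pos_left hsupp hΛ0
      _ = 2 * (Λ * θ) * ρ := by ring
      _ = ρ := by rw [hΛθ]; ring
  have h := depth_gain_lattice hSo hS hΦ hN h0 hβ0 hβ hδ hΛ1 h4 ha hρ
  calc ‖Φ (fun b => exp (B b))‖ ≤ N / Λ := h
    _ = 2 * θ * N := by rw [hΛ_def]; field_simp

/-- **THE LATTICE DEPTH GAIN (two regimes).**  Without the support-size condition: for `0 < β`, `2β < ρ` and the other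
hypotheses of the deep regime, `‖Φ(exp B)‖ ≤ N·max(2θ, 2β/ρ)` — the gain is the relative depth unless the potential
radius binds (`Λ = min(1/(2θ), ρ/(2β))`); on the road `β/ρ ≍ (d−1)·diam·θ/B`, so the second member is the depth times a
factor LINEAR in the diameter of the localization domain, absorbed by its locality weight. [folklore] -/
theorem depth_gain_lattice_two_regime {S : Set (𝔅 → 𝔸)} {plaqs : Set (𝔅 × 𝔅 × 𝔅 × 𝔅)} {a ρ N : ℝ}
    {Φ : (𝔅 → 𝔸) → F} (hSo : IsOpen S) (hS : ContainsSmall S plaqs a ρ) (hΦ : DifferentiableOn ℂ Φ S)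
    (hN : ∀ V ∈ S, ‖Φ V‖ ≤ N) (h0 : Φ 1 = 0) {B : 𝔅 → 𝔸} {β δ θ : ℝ} (hβ0 : 0 < β) (hβ : ∀ b, ‖B b‖ ≤ β)
    (hδ : ∀ p ∈ plaqs, ‖discHol B p 1 - 1‖ ≤ δ) (hθ0 : 0 < θ) (hθ : θ < 1 / 2) (ha1 : a ≤ 1)
    (hδθ : δ ≤ θ * a) (hquad : 16 * β ^ 2 < θ ^ 2 * a) (hβρ : 2 * β < ρ) :
    ‖Φ (fun b => exp (B b))‖ ≤ N * max (2 * θ) (2 * β / ρ) := by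
  have hρ0 : 0 < ρ := by linarith
  have ha0 : 0 < a := by nlinarith
  have hN0 : 0 ≤ N := by
    have := hN 1 (one_mem_of_containsSmall hS ha0 hρ0)
    rw [h0, norm_zero] at this
    exact this
  set Λ : ℝ := min (1 / (2 * θ)) (ρ / (2 * β)) with hΛ_def
  have hΛle1 : Λ ≤ 1 / (2 * θ) := min_le_left _ _
  have hΛle2 : Λ ≤ ρ / (2 * β) := min_le_right _ _
  have hΛ1 : 1 < Λ := by
    rw [hΛ_def, lt_min_iff]
    constructor
    · rw [lt_div_iff₀ (by positivity)]; linarith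
    · rw [lt_div_iff₀ (by positivity)]; linarith
  have hΛ0 : 0 < Λ := zero_lt_one.trans hΛ1
  have hΛθ : Λ * θ ≤ 1 / 2 := by
    calc Λ * θ ≤ 1 / (2 * θ) * θ := mul_le_mul_of_nonneg_right hΛle1 hθ0.le
      _ = 1 / 2 := by field_simp
  have hΛβ : Λ * β ≤ ρ / 2 := by
    calc Λ * β ≤ ρ / (2 * β) * β := mul_le_mul_of_nonneg_right hΛle2 hβ0.le
      _ = ρ / 2 := by field_simp
  have hβθ : 2 * β ≤ θ := by nlinarith
  have h4 : 4 * Λ * β ≤ 1 := by nlinarith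
  have ha : Λ * δ + 32 * Λ ^ 2 * β ^ 2 < a := by
    have e1 : Λ * δ ≤ a / 2 := by
      calc Λ * δ ≤ Λ * (θ * a) := mul_le_mul_of_nonneg_left hδθ hΛ0.le
        _ = (Λ * θ) * a := by ring
        _ ≤ (1 / 2) * a := mul_le_mul_of_nonneg_right hΛθ ha0.le
        _ = a / 2 := by ring
    have e2 : 32 * Λ ^ 2 * β ^ 2 < a / 2 := by
      have hΛθ2 : (Λ * θ) ^ 2 ≤ (1 / 2) ^ 2 := by
        apply pow_le_pow_left₀ (by positivity) hΛθ
      have : 32 * Λ ^ 2 * β ^ 2 = 2 * Λ ^ 2 * (16 * β ^ 2) := by ring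
      rw [this]
      calc 2 * Λ ^ 2 * (16 * β ^ 2) < 2 * Λ ^ 2 * (θ ^ 2 * a) :=
            mul_lt_mul_of_pos_left hquad (by positivity)
        _ = 2 * (Λ * θ) ^ 2 * a := by ring
        _ ≤ 2 * (1 / 2) ^ 2 * a := by nlinarith
        _ = a / 2 := by ring
    linarith
  have hρ : Λ * β < ρ := by linarith
  have h := depth_gain_lattice hSo hS hΦ hN h0 hβ0.le hβ hδ hΛ1 h4 ha hρ
  -- `N/Λ = N · max(2θ, 2β/ρ)` since `1/Λ = max (2θ) (2β/ρ)`
  have hinv : 1 / Λ = max (2 * θ) (2 * β / ρ) := by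
    rcases le_total (1 / (2 * θ)) (ρ / (2 * β)) with hle | hle
    · have hΛeq : Λ = 1 / (2 * θ) := by rw [hΛ_def]; exact min_eq_left hle
      have hcmp : 2 * β / ρ ≤ 2 * θ := by
        rw [div_le_div_iff₀ (by positivity) (by positivity)] at hle
        rw [div_le_iff₀ hρ0]; nlinarith
      rw [hΛeq, max_eq_left hcmp]; field_simp
    · have hΛeq : Λ = ρ / (2 * β) := by rw [hΛ_def]; exact min_eq_right hle
      have hcmp : 2 * θ ≤ 2 * β / ρ := by
        rw [div_le_div_iff₀ (by positivity) (by positivity)] at hle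
        rw [le_div_iff₀ hρ0]; nlinarith
      rw [hΛeq, max_eq_right hcmp]; field_simp
  calc ‖Φ (fun b => exp (B b))‖ ≤ N / Λ := h
    _ = N * (1 / Λ) := by ring
    _ = N * max (2 * θ) (2 * β / ρ) := by rw [hinv]

end Gain

end Summit.QuantumFields.BalabanUV.T4Continuum.CovariantMeanLatticeDisc

end
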